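/-
Copyright: the b2b-balaban T⁴-continuum CRUX team, row NE7b OWNER lineage `t4-ne7b-p1` (gen 130). Project licence.
-/
import Summits.QuantumFields.BalabanUV.T4Continuum.Spine.NE7b.SupRegulatedTiltedMoments
import Summits.QuantumFields.BalabanUV.T4Continuum.Spine.NE7b.SupTwoSitePerturbationLocality

/-!
# THE ROAD'S TWO-SITE TILTED FAMILY AS AN EXPONENTIAL FAMILY, WITH ITS LETTERS: for the small-field step with remainders `w` and two one-site
# quadratic profiles `F` at `y ∈ cell p₀`, `G` at `z ∈ cell p₁` (`p₀, p₁ ∈ S`),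
#   `∫e^{−Σ_{p∈S}Σ_{x∈cell p}(w − s1_yF − t1_zG)(ω+ψ₀)}dN(0,Γ) = ∫e^{−V(ω)}·e^{sA(ω)+tB(ω)}dN(0,Γ)`,  `A = F_y(ω_y+ψ₀,y)`, `B = G_z(ω_z+ψ₀,z)`,
# i.e. (326)'s `Z(s,t)` IS the exponential family `H(s,t)` of (330) with weight `Φ₀ = e^{−V}`; and the road supplies its letters: `H > 0`,
# the `4`-letter `∫e^{−V}e^{4(|A|+|B|)} < ∞` (regulator with `κ₀ + 8c₂`), and — through (329) on the `(s,t)`-perturbed family (stable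
# `κ₀+2c₂`, sup-small `c₃h³+2c₂h²`) — the single-site Gaussian moment letter `∫e^{−V}φ(ω_q+ψ₀,q)e^{sA+tB} ≤ H(s,t)·aM` for every `φ ≤ ae^{δ₀v²}`
# at `q ∈ {y, z}`, uniformly in `|s|, |t| ≤ 1` and in the volume (row NE7b, node U5c; (314)∕(326)∕(329) BY NAME; [folklore])

Cell `pub-balaban`, sub-cell `t4`, spine estimate NE7b (`T4WeightBudget.RelWeightBound`; the cell's OWN estimate — NOT PRINTED in
[Bałaban 1983–89], NOT PROVED).  Crux-route work under `Spine/NE7b/` by the row OWNER (`t4-ne7b-p1` gen 130, file (332a)) under FREEZE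
(0)'s crux-prover clause, on § [NE7bP1-G129-HANDOFF] NEXT (i)∕(ii) (SCOPING-d4: the road's discharge of (330)∕(331)'s hypotheses); NOTHING
of Bałaban's is named as a Lean object, valued or asserted; no `T4Continuum/Support` leaf typed; no `def`, no notation; zero `sorry`.
Imports (BY NAME): the OWNER's (329) `…SupRegulatedTiltedMoments` (`tilted_mean_le_of_supSmall`), (326) `…SupTwoSitePerturbationLocality`
(`twoSite_measurable`, `twoSite_stable`, `twoSite_supSmall`), (323) (`integrable_exp_neg_mul_expSq` through (329)), (314) (`oneSite_cellSum`),
(313) (`mul_opBound_le_of_le`), (306) (`cellSum_eq_sum_biUnion`), (297) (`integrable_exp_neg`).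

WHAT IS PROVED ([folklore]; road data as in (326)):
* §1 **`twoSite_cellSum`** (`Σ_{p∈S}Σ_{x∈cell p}(w − s1_yF − t1_zG)(ω+ψ) = V − sF_y(ω_y+ψ_y) − tG_z(ω_z+ψ_z)`), **`twoSite_integrand_eq`**
  (`e^{−Σw̃(ω+ψ₀)} = e^{−V}·e^{sA+tB}`), `twoSite_integral_eq` (`Z(s,t) = H(s,t)`);
* §2 **`road_H_pos`** (`H(s,t) > 0`, `|s|, |t| ≤ 1`, regulator with `κ₀ + 2c₂`), **`road_four_letter`** (`∫|e^{−V}|e^{4(|A|+|B|)}dN(0,Γ) < ∞`,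
  regulator with `κ₀ + 8c₂`, `|F|, |G| ≤ c₂u²`);
* §3 THE END **`road_moment_letter`** (`q ∈ cell p_q`, `p_q ∈ S`, `0 ≤ φ ≤ a·e^{δ₀v²}`, `|s|, |t| ≤ 1`, KP smallness with
  `ε̃' = max(e^{v(c₃h³+2c₂h²+δ₀h²)}−1, 2e^{−(κ∕2−(κ₀+2c₂+δ₀))h²})` ⟹ `∫e^{−V}φ(ω_q+ψ₀,q)e^{sA+tB}dN(0,Γ) ≤ H(s,t)·(a·exp(2(Δ+1)2e·ε̃'_ΨA_τ^v))`);
  §4 toy.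

HONEST (what this is NOT).  Letters only; the assembly `|Cov_ν(F_y,G_z)| ≤ …e^{−η(n+1)}…` with (326)∕(327)∕(330)∕(331) is the next file;
small-field step only; scalar skeleton ((A3), NC-NE7b-α UNRULED); nothing of Bałaban's asserted.  BY-NAME EFFECT ON THE WALL: NONE.  NE7b
NOT PRINTED ∕ NOT PROVED; spine PROVED 0∕9; rung (B)+1 — the programme's measures remain FINITE-torus statements; NOT the mass gap, NOT Clay.
HONEST DEPENDENCY: continuum YM on T⁴ ⇐ BetaPertH ∧ nine spine estimates (0∕9 proved); BetaPertH ⇐ (D1) ∧ (D4) ∧ CAP+tail; G-an2-4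
gates asym, D1 and NE2∕3∕4.
-/

set_option autoImplicit false

noncomputable section

namespace Summit.QuantumFields.BalabanUV.T4Continuum.NE7b.SupTiltedFamilyLetters

open MeasureTheory ProbabilityTheory Finset Real
open scoped BigOperators
open Literature.Analysis.Matrix (HasFiniteRange)
open SupRegulatedTiltedMoments (tilted_mean_le_of_supSmall)
open SupTwoSitePerturbationLocality (twoSite_measurable twoSite_stable twoSite_supSmall)
open SupTiltedSingleSiteMoments (integrable_exp_neg_mul_expSq)
open SupOneSitePerturbation (oneSite_cellSum)
open SupEffectiveActionDerivative (mul_opBound_le_of_le)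
open SupSmallFieldGasReal (cellSum_eq_sum_biUnion)
open SupFluctuationAPriori (integrable_exp_neg)

variable {ι : Type} [Fintype ι] [DecidableEq ι] {V : Type*} [DecidableEq V]

/-! ## §1. The two-site family's exponent is `V − sA − tB` -/

omit [Fintype ι] in
/-- **The two-site perturbed cell sum**: disjoint cells, `y ∈ cell p₀`, `z ∈ cell p₁`, `p₀, p₁ ∈ S` ⟹
`Σ_{p∈S}Σ_{x∈cell p}(w_x − s1_{x=y}F_x − t1_{x=z}G_x)(ω_x+ψ_x) = Σ_{p∈S}Σ_{x∈cell p}w_x(ω_x+ψ_x) − sF_y(ω_y+ψ_y) − tG_z(ω_z+ψ_z)`. [folklore] -/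
theorem twoSite_cellSum (w F G : ι → ℝ → ℝ) (y z : ι) (s t : ℝ) (cell : V → Finset ι) (hdisj : ∀ p q, p ≠ q → Disjoint (cell p) (cell q))
    (S : Finset V) {p₀ p₁ : V} (hp₀ : p₀ ∈ S) (hp₁ : p₁ ∈ S) (hy : y ∈ cell p₀) (hz : z ∈ cell p₁) (ω ψ : ι → ℝ) :
    ∑ p ∈ S, ∑ x ∈ cell p, (w x (ω x + ψ x) - s * (if x = y then F x (ω x + ψ x) else 0) - t * (if x = z then G x (ω x + ψ x) else 0)) =
      ∑ p ∈ S, ∑ x ∈ cell p, w x (ω x + ψ x) - s * F y (ω y + ψ y) - t * G z (ω z + ψ z) := by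
  rw [oneSite_cellSum (fun x u => w x u - s * (if x = y then F x u else 0)) G z t cell hdisj S hp₁ hz ω ψ,
    oneSite_cellSum w F y s cell hdisj S hp₀ hy ω ψ]

omit [Fintype ι] in
/-- **The two-site integrand IS the exponential-family integrand**: `e^{−Σw̃(ω+ψ₀)} = e^{−V(ω)}·e^{sA(ω)+tB(ω)}`. [folklore] -/
theorem twoSite_integrand_eq (w F G : ι → ℝ → ℝ) (y z : ι) (s t : ℝ) (cell : V → Finset ι) (hdisj : ∀ p q, p ≠ q → Disjoint (cell p) (cell q))
    (S : Finset V) {p₀ p₁ : V} (hp₀ : p₀ ∈ S) (hp₁ : p₁ ∈ S) (hy : y ∈ cell p₀) (hz : z ∈ cell p₁) (ω ψ : ι → ℝ) :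
    exp (-(∑ p ∈ S, ∑ x ∈ cell p,
        (w x (ω x + ψ x) - s * (if x = y then F x (ω x + ψ x) else 0) - t * (if x = z then G x (ω x + ψ x) else 0)))) =
      exp (-(∑ p ∈ S, ∑ x ∈ cell p, w x (ω x + ψ x))) * exp (s * F y (ω y + ψ y) + t * G z (ω z + ψ z)) := by
  rw [twoSite_cellSum w F G y z s t cell hdisj S hp₀ hp₁ hy hz ω ψ, ← exp_add]
  congr 1
  ring

omit [Fintype ι] in
/-- **(326)'s `Z(s,t)` IS (330)'s `H(s,t)`** with the weight `e^{−V}`. [folklore] -/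
theorem twoSite_integral_eq (μ : Measure (EuclideanSpace ℝ ι)) (w F G : ι → ℝ → ℝ) (y z : ι) (s t : ℝ) (cell : V → Finset ι)
    (hdisj : ∀ p q, p ≠ q → Disjoint (cell p) (cell q)) (S : Finset V) {p₀ p₁ : V} (hp₀ : p₀ ∈ S) (hp₁ : p₁ ∈ S) (hy : y ∈ cell p₀)
    (hz : z ∈ cell p₁) (ψ₀ : EuclideanSpace ℝ ι) :
    ∫ ω : EuclideanSpace ℝ ι, exp (-(∑ p ∈ S, ∑ x ∈ cell p,
        (w x (ω x + ψ₀ x) - s * (if x = y then F x (ω x + ψ₀ x) else 0) - t * (if x = z then G x (ω x + ψ₀ x) else 0)))) ∂μ =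
      ∫ ω : EuclideanSpace ℝ ι, exp (-(∑ p ∈ S, ∑ x ∈ cell p, w x (ω x + ψ₀ x))) *
        exp (s * F y (ω y + ψ₀ y) + t * G z (ω z + ψ₀ z)) ∂μ :=
  integral_congr_ae (ae_of_all _ fun ω => twoSite_integrand_eq w F G y z s t cell hdisj S hp₀ hp₁ hy hz (fun x => ω x) (fun x => ψ₀ x))

/-! ## §2. Positivity and the `4`-letter -/

section Main

variable {Γ : Matrix ι ι ℝ} {γop γ : ℝ} {dι : ι → ι → ℕ} {ρ : ℕ} {cell : V → Finset ι} {v : ℕ} {R : V → V → Prop}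
  [DecidableRel R] [Std.Symm R] {nbr : V → Finset V} {Δ : ℕ} {w F G : ι → ℝ → ℝ} {κ₀ c₂ c₃ h κ τ θ Ψ δ₀ : ℝ}

omit [DecidableRel R] [Std.Symm R] in
/-- **The two-site integrand is integrable** (`|s|, |t| ≤ 1`; stability `κ₀ + 2c₂`; `2(κ₀+2c₂)(1+τ)γ_op ≤ θ < 1`). [folklore] -/
theorem integrable_twoSite (hΓ : Γ.PosSemidef) (hΓop : (γop • (1 : Matrix ι ι ℝ) - Γ).PosSemidef)
    (hdisj : ∀ p q, p ≠ q → Disjoint (cell p) (cell q)) (hw : ∀ x, Measurable (w x)) (hFm : ∀ x, Measurable (F x))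
    (hGm : ∀ x, Measurable (G x)) (hκ₀ : 0 ≤ κ₀) (hc₂ : 0 ≤ c₂) (hstab : ∀ x, ∀ u : ℝ, -(κ₀ * u ^ 2) ≤ w x u)
    (hFq : ∀ x u, |F x u| ≤ c₂ * u ^ 2) (hGq : ∀ x u, |G x u| ≤ c₂ * u ^ 2) (hτ : 0 < τ) (hθ1 : θ < 1)
    (hκθ₂ : 2 * (κ₀ + 2 * c₂) * (1 + τ) * γop ≤ θ) (S : Finset V) (ψ₀ : EuclideanSpace ℝ ι) {p₀ p₁ : V} (hp₀ : p₀ ∈ S) (hp₁ : p₁ ∈ S)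
    {y z : ι} (hy : y ∈ cell p₀) (hz : z ∈ cell p₁) {s t : ℝ} (hs : |s| ≤ 1) (ht : |t| ≤ 1) :
    Integrable (fun ω : EuclideanSpace ℝ ι => exp (-(∑ p ∈ S, ∑ x ∈ cell p, w x (ω x + ψ₀ x))) *
      exp (s * F y (ω y + ψ₀ y) + t * G z (ω z + ψ₀ z))) (multivariateGaussian 0 Γ) := by
  have h := integrable_exp_neg hΓ hΓop (S.biUnion cell)
    (fun x u => w x u - s * (if x = y then F x u else 0) - t * (if x = z then G x u else 0))
    (fun x => twoSite_measurable w F G y z s t hw hFm hGm x) (by positivity) hτ hθ1 hκθ₂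
    (twoSite_stable w F G y z s t hc₂ hstab hFq hGq hs ht) (fun x => ψ₀ x)
  refine h.congr (ae_of_all _ fun ω => ?_)
  simp only
  rw [← cellSum_eq_sum_biUnion cell hdisj S]
  exact twoSite_integrand_eq w F G y z s t cell hdisj S hp₀ hp₁ hy hz (fun x => ω x) (fun x => ψ₀ x)

omit [DecidableRel R] [Std.Symm R] in
/-- **`H(s,t) > 0`** on the square. [folklore] -/
theorem road_H_pos (hΓ : Γ.PosSemidef) (hΓop : (γop • (1 : Matrix ι ι ℝ) - Γ).PosSemidef)
    (hdisj : ∀ p q, p ≠ q → Disjoint (cell p) (cell q)) (hw : ∀ x, Measurable (w x)) (hFm : ∀ x, Measurable (F x))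
    (hGm : ∀ x, Measurable (G x)) (hκ₀ : 0 ≤ κ₀) (hc₂ : 0 ≤ c₂) (hstab : ∀ x, ∀ u : ℝ, -(κ₀ * u ^ 2) ≤ w x u)
    (hFq : ∀ x u, |F x u| ≤ c₂ * u ^ 2) (hGq : ∀ x u, |G x u| ≤ c₂ * u ^ 2) (hτ : 0 < τ) (hθ1 : θ < 1)
    (hκθ₂ : 2 * (κ₀ + 2 * c₂) * (1 + τ) * γop ≤ θ) (S : Finset V) (ψ₀ : EuclideanSpace ℝ ι) {p₀ p₁ : V} (hp₀ : p₀ ∈ S) (hp₁ : p₁ ∈ S)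
    {y z : ι} (hy : y ∈ cell p₀) (hz : z ∈ cell p₁) {s t : ℝ} (hs : |s| ≤ 1) (ht : |t| ≤ 1) :
    0 < ∫ ω : EuclideanSpace ℝ ι, exp (-(∑ p ∈ S, ∑ x ∈ cell p, w x (ω x + ψ₀ x))) *
      exp (s * F y (ω y + ψ₀ y) + t * G z (ω z + ψ₀ z)) ∂(multivariateGaussian 0 Γ) := by
  have hI := integrable_twoSite hΓ hΓop hdisj hw hFm hGm hκ₀ hc₂ hstab hFq hGq hτ hθ1 hκθ₂ S ψ₀ hp₀ hp₁ hy hz hs ht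
  have hI' : Integrable (fun ω : EuclideanSpace ℝ ι => exp (-(∑ p ∈ S, ∑ x ∈ cell p, w x (ω x + ψ₀ x)) +
      (s * F y (ω y + ψ₀ y) + t * G z (ω z + ψ₀ z)))) (multivariateGaussian 0 Γ) :=
    hI.congr (ae_of_all _ fun ω => by simp only [exp_add])
  refine (integral_exp_pos hI').trans_le (le_of_eq (integral_congr_ae (ae_of_all _ fun ω => ?_)))
  simp only [exp_add]

omit [DecidableRel R] [Std.Symm R] in
/-- **THE `4`-LETTER OF THE WEIGHT `e^{−V}`**: `|F|, |G| ≤ c₂u²`, stability, `2(κ₀+8c₂)(1+τ)γ_op ≤ θ < 1` ⟹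
`∫|e^{−V}|·e^{4(|A|+|B|)}dN(0,Γ) < ∞` (the two-site family with profiles `4c₂u²` is stable with `κ₀ + 8c₂`). [folklore] -/
theorem road_four_letter (hΓ : Γ.PosSemidef) (hΓop : (γop • (1 : Matrix ι ι ℝ) - Γ).PosSemidef)
    (hdisj : ∀ p q, p ≠ q → Disjoint (cell p) (cell q)) (hw : ∀ x, Measurable (w x)) (hFm : ∀ x, Measurable (F x))
    (hGm : ∀ x, Measurable (G x)) (hκ₀ : 0 ≤ κ₀) (hc₂ : 0 ≤ c₂) (hstab : ∀ x, ∀ u : ℝ, -(κ₀ * u ^ 2) ≤ w x u)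
    (hFq : ∀ x u, |F x u| ≤ c₂ * u ^ 2) (hGq : ∀ x u, |G x u| ≤ c₂ * u ^ 2) (hτ : 0 < τ) (hθ1 : θ < 1)
    (hκθ₈ : 2 * (κ₀ + 2 * (4 * c₂)) * (1 + τ) * γop ≤ θ) (S : Finset V) (ψ₀ : EuclideanSpace ℝ ι) {p₀ p₁ : V} (hp₀ : p₀ ∈ S)
    (hp₁ : p₁ ∈ S) {y z : ι} (hy : y ∈ cell p₀) (hz : z ∈ cell p₁) :
    Integrable (fun ω : EuclideanSpace ℝ ι => |exp (-(∑ p ∈ S, ∑ x ∈ cell p, w x (ω x + ψ₀ x)))| *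
      exp (4 * (|F y (ω y + ψ₀ y)| + |G z (ω z + ψ₀ z)|))) (multivariateGaussian 0 Γ) := by
  -- the dominating family: profiles `4c₂u²` at `y` and `z` with `s = t = 1`
  have h1 : |(1 : ℝ)| ≤ 1 := by rw [abs_one]
  have hdom := integrable_twoSite hΓ hΓop hdisj hw (F := fun _ u => 4 * c₂ * u ^ 2) (G := fun _ u => 4 * c₂ * u ^ 2)
    (fun _ => (measurable_id.pow_const 2).const_mul _) (fun _ => (measurable_id.pow_const 2).const_mul _) hκ₀ (by positivity : 0 ≤ 4 * c₂)
    hstab (fun x u => by rw [abs_of_nonneg (by positivity)]) (fun x u => by rw [abs_of_nonneg (by positivity)]) hτ hθ1 hκθ₈ S ψ₀ hp₀ hp₁ hy hz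
    h1 h1
  have hmeas : AEStronglyMeasurable (fun ω : EuclideanSpace ℝ ι => |exp (-(∑ p ∈ S, ∑ x ∈ cell p, w x (ω x + ψ₀ x)))| *
      exp (4 * (|F y (ω y + ψ₀ y)| + |G z (ω z + ψ₀ z)|))) (multivariateGaussian 0 Γ) := by
    refine ((continuous_abs.measurable.comp (measurable_exp.comp
      (SupSmallFieldGasReal.measurable_cellSum cell w hw S (fun x => ψ₀ x)).neg)).mul (measurable_exp.comp ?_)).aestronglyMeasurable
    exact ((continuous_abs.measurable.comp ((hFm y).comp ((by fun_prop : Measurable fun ω : EuclideanSpace ℝ ι => ω y).add_const _))).add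
      (continuous_abs.measurable.comp ((hGm z).comp ((by fun_prop : Measurable fun ω : EuclideanSpace ℝ ι => ω z).add_const _)))).const_mul 4
  refine hdom.mono' hmeas (ae_of_all _ fun ω => ?_)
  rw [Real.norm_of_nonneg (mul_nonneg (abs_nonneg _) (exp_pos _).le), abs_of_pos (exp_pos _)]
  refine mul_le_mul_of_nonneg_left (exp_le_exp.2 ?_) (exp_pos _).le
  have hA := hFq y (ω y + ψ₀ y)
  have hB := hGq z (ω z + ψ₀ z)
  linarith

/-! ## §3. THE END: the single-site moment letter under the tilted law of the perturbed family -/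

/-- **THE END — THE MOMENT LETTER.**  Road data as in (326) (`|F|, |G| ≤ c₂u²`, `|w| ≤ c₃|t|³` on `|t| ≤ h`, stability `κ₀`); a site `q ∈ cell p_q`,
`p_q ∈ S`; `0 ≤ δ₀`, `2((κ₀+2c₂)+δ₀) ≤ κ`, `κ(1+τ)γ_op ≤ θ < 1`; `ψ₀` small on the cells of `S`; KP smallness with
`ε̃' = max(e^{v((c₃h³+2c₂h²)+δ₀h²)}−1, 2e^{−(κ∕2−((κ₀+2c₂)+δ₀))h²})`; any `φ` with `0 ≤ φ(v) ≤ a·e^{δ₀v²}`; `|s|, |t| ≤ 1` ⟹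
`∫e^{−V}φ(ω_q+ψ₀,q)e^{sA+tB}dN(0,Γ) ≤ H(s,t)·(a·exp(2(Δ+1)2e·ε̃'_ΨA_τ^v))` — (329) on the `(s,t)`-perturbed family. [folklore] -/
theorem road_moment_letter (hΓ : Γ.PosSemidef) (hΓop : (γop • (1 : Matrix ι ι ℝ) - Γ).PosSemidef) (hdiag : ∀ i, Γ i i ≤ γ)
    (hγ : 0 ≤ γ) (hfr : HasFiniteRange dι ρ Γ) (hdisj : ∀ p q, p ≠ q → Disjoint (cell p) (cell q)) (hv : ∀ p, (cell p).card ≤ v)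
    (hR : ∀ (p p' : V) (x y : ι), x ∈ cell p → y ∈ cell p' → dι x y ≤ ρ → p = p' ∨ R p p')
    (hΔ : ∀ x, (nbr x).card ≤ Δ) (hnbr : ∀ x y, R x y → y ∈ nbr x) (hw : ∀ x, Measurable (w x)) (hFm : ∀ x, Measurable (F x))
    (hGm : ∀ x, Measurable (G x)) (hκ₀ : 0 ≤ κ₀) (hc₂ : 0 ≤ c₂) (hc₃ : 0 ≤ c₃) (hh : 0 ≤ h) (hδ₀ : 0 ≤ δ₀)
    (hstab : ∀ x, ∀ u : ℝ, -(κ₀ * u ^ 2) ≤ w x u) (hcub : ∀ x, ∀ u : ℝ, |u| ≤ h → |w x u| ≤ c₃ * |u| ^ 3)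
    (hFq : ∀ x u, |F x u| ≤ c₂ * u ^ 2) (hGq : ∀ x u, |G x u| ≤ c₂ * u ^ 2) (hκ : 2 * ((κ₀ + 2 * c₂) + δ₀) ≤ κ) (hτ : 0 < τ)
    (hθ0 : 0 < θ) (hθ1 : θ < 1) (hκθ : κ * (1 + τ) * γop ≤ θ) (S : Finset V) (ψ₀ : EuclideanSpace ℝ ι)
    (hψ : ∀ p ∈ S, ∑ x ∈ cell p, ψ₀ x ^ 2 ≤ Ψ ^ 2) {p₀ p₁ pq : V} (hp₀ : p₀ ∈ S) (hp₁ : p₁ ∈ S) (hpq : pq ∈ S) {y z q : ι}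
    (hy : y ∈ cell p₀) (hz : z ∈ cell p₁) (hq : q ∈ cell pq)
    (hsmall : Real.exp 1 * (((max (exp (v * ((c₃ * h ^ 3 + 2 * c₂ * h ^ 2) + δ₀ * h ^ 2)) - 1)
      (2 * exp (-((κ / 2 - ((κ₀ + 2 * c₂) + δ₀)) * h ^ 2)))) * exp (κ * (1 + τ⁻¹) * Ψ ^ 2 / 2)) *
      ((1 - θ) ^ (-(κ * (1 + τ) * γ / (2 * θ)))) ^ v) * ((Δ : ℝ) + 1) ^ 2 ≤ 1 / 2)
    {φ : ℝ → ℝ} {a : ℝ} (hφ0 : ∀ u, 0 ≤ φ u) (hφ : ∀ u, φ u ≤ a * exp (δ₀ * u ^ 2)) {s t : ℝ} (hs : |s| ≤ 1) (ht : |t| ≤ 1) :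
    ∫ ω : EuclideanSpace ℝ ι, exp (-(∑ p ∈ S, ∑ x ∈ cell p, w x (ω x + ψ₀ x))) * φ (ω q + ψ₀ q) *
        exp (s * F y (ω y + ψ₀ y) + t * G z (ω z + ψ₀ z)) ∂(multivariateGaussian 0 Γ) ≤
      (∫ ω : EuclideanSpace ℝ ι, exp (-(∑ p ∈ S, ∑ x ∈ cell p, w x (ω x + ψ₀ x))) *
        exp (s * F y (ω y + ψ₀ y) + t * G z (ω z + ψ₀ z)) ∂(multivariateGaussian 0 Γ)) *
      (a * exp (2 * ((1 : ℝ) * ((Δ : ℝ) + 1) * (2 * (Real.exp 1 * (((max (exp (v * ((c₃ * h ^ 3 + 2 * c₂ * h ^ 2) + δ₀ * h ^ 2)) - 1)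
        (2 * exp (-((κ / 2 - ((κ₀ + 2 * c₂) + δ₀)) * h ^ 2)))) * exp (κ * (1 + τ⁻¹) * Ψ ^ 2 / 2)) *
        ((1 - θ) ^ (-(κ * (1 + τ) * γ / (2 * θ)))) ^ v)))))) := by
  set μ := multivariateGaussian 0 Γ with hμ
  -- (329) on the `(s,t)`-perturbed family
  have key := tilted_mean_le_of_supSmall (w := fun x u => w x u - s * (if x = y then F x u else 0) - t * (if x = z then G x u else 0))
    hΓ hΓop hdiag hγ hfr hdisj hv hR hΔ hnbr (fun x => twoSite_measurable w F G y z s t hw hFm hGm x) (by positivity : 0 ≤ κ₀ + 2 * c₂) hδ₀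
    (by positivity : 0 ≤ c₃ * h ^ 3 + 2 * c₂ * h ^ 2) hh (twoSite_stable w F G y z s t hc₂ hstab hFq hGq hs ht)
    (twoSite_supSmall w F G y z s t hc₃ hc₂ hcub hFq hGq hs ht) hκ hτ hθ0 hθ1 hκθ S ψ₀ hψ hpq hq hsmall hφ0 hφ
  -- rewrite both integrals through the exponential family
  have e1 : ∫ ω : EuclideanSpace ℝ ι, exp (-(∑ p ∈ S, ∑ x ∈ cell p,
      (w x (ω x + ψ₀ x) - s * (if x = y then F x (ω x + ψ₀ x) else 0) - t * (if x = z then G x (ω x + ψ₀ x) else 0)))) ∂μ =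
      ∫ ω : EuclideanSpace ℝ ι, exp (-(∑ p ∈ S, ∑ x ∈ cell p, w x (ω x + ψ₀ x))) * exp (s * F y (ω y + ψ₀ y) + t * G z (ω z + ψ₀ z)) ∂μ :=
    twoSite_integral_eq μ w F G y z s t cell hdisj S hp₀ hp₁ hy hz ψ₀
  have e2 : ∫ ω : EuclideanSpace ℝ ι, exp (-(∑ p ∈ S, ∑ x ∈ cell p,
      (w x (ω x + ψ₀ x) - s * (if x = y then F x (ω x + ψ₀ x) else 0) - t * (if x = z then G x (ω x + ψ₀ x) else 0)))) *
        φ (ω q + ψ₀ q) ∂μ =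
      ∫ ω : EuclideanSpace ℝ ι, exp (-(∑ p ∈ S, ∑ x ∈ cell p, w x (ω x + ψ₀ x))) * φ (ω q + ψ₀ q) *
        exp (s * F y (ω y + ψ₀ y) + t * G z (ω z + ψ₀ z)) ∂μ :=
    integral_congr_ae (ae_of_all _ fun ω => by
      dsimp only
      rw [twoSite_integrand_eq w F G y z s t cell hdisj S hp₀ hp₁ hy hz (fun x => ω x) (fun x => ψ₀ x)]
      ring)
  rw [e1, e2] at key
  have hH := road_H_pos hΓ hΓop hdisj hw hFm hGm hκ₀ hc₂ hstab hFq hGq hτ hθ1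
    (mul_opBound_le_of_le (a := 2 * (κ₀ + 2 * c₂) * (1 + τ)) (b := κ * (1 + τ)) (by positivity)
      (mul_le_mul_of_nonneg_right (by linarith) (by linarith)) hθ0.le (by simpa [mul_assoc] using hκθ) |> fun h' => by
        simpa [mul_assoc] using h') S ψ₀ hp₀ hp₁ hy hz hs ht
  rwa [inv_mul_le_iff₀ hH] at key

end Main

/-! ## §4. Toy -/

/-- Toy (§1): with the ZERO remainder and zero profiles on a one-cell lattice the two-site cell sum reads `0 = 0 − s·0 − t·0`. -/
example (s t : ℝ) (ω ψ : Fin 1 → ℝ) :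
    ∑ p ∈ ({()} : Finset Unit), ∑ x ∈ (fun _ : Unit => (Finset.univ : Finset (Fin 1))) p,
        ((fun (_ : Fin 1) (_ : ℝ) => (0 : ℝ)) x (ω x + ψ x) - s * (if x = 0 then (fun (_ : Fin 1) (_ : ℝ) => (0 : ℝ)) x (ω x + ψ x) else 0) -
          t * (if x = 0 then (fun (_ : Fin 1) (_ : ℝ) => (0 : ℝ)) x (ω x + ψ x) else 0)) =
      ∑ p ∈ ({()} : Finset Unit), ∑ x ∈ (fun _ : Unit => (Finset.univ : Finset (Fin 1))) p, (fun (_ : Fin 1) (_ : ℝ) => (0 : ℝ)) x (ω x + ψ x) -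
        s * (fun (_ : Fin 1) (_ : ℝ) => (0 : ℝ)) 0 (ω 0 + ψ 0) - t * (fun (_ : Fin 1) (_ : ℝ) => (0 : ℝ)) 0 (ω 0 + ψ 0) :=
  twoSite_cellSum (fun _ _ => 0) (fun _ _ => 0) (fun _ _ => 0) 0 0 s t (fun _ : Unit => Finset.univ) (fun p q hpq => absurd (Subsingleton.elim p q) hpq)
    {()} (Finset.mem_singleton_self _) (Finset.mem_singleton_self _) (Finset.mem_univ _) (Finset.mem_univ _) ω ψ

end Summit.QuantumFields.BalabanUV.T4Continuum.NE7b.SupTiltedFamilyLetters
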